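import Summits.BirchSwinnertonDyer.BirchSwinnertonDyer.Theorems.SylvesterTwoHeegnerIndexLevelFixingDecompositionInvolution
import Summits.BirchSwinnertonDyer.BirchSwinnertonDyer.Theorems.SylvesterTwoHeegnerIndexLevelFixingOfTranslation
import HarnessLib

/-!
# ★★★ (W2-b) `stub_levelFixingSeven` FOR EVERY `⟨W, A⟩`-INVARIANT DEGREE-6 PARAMETRISATION — every class of `p mod 27`,
# every Kolyvagin level `n`: the decomposition involution at `w ∣ 3` fixes Hu–Shu–Yin's point `y_n ∈ E₉(K[9pn])`
# (crux `UpperOffV0HSYPlus`, stmt-BirchSwinnertonDyer-19804; route `SylvesterTwoHeegnerIndex`, rung K7t; route (4.2) assembled)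

Cell `bsd-cm`, seat `bsd-cm-k7t-c2` g33 ((W2-b) seat of record).  Helper toward `stmt-BirchSwinnertonDyer-19804`
(`--supports … --as helper`).  THEOREMS ONLY (no definition, no named fact, no instance, no `sorry`).

THE ASSEMBLY.  The registered research stub (skeleton VARIANT R′ `Cruxes/UpperOffV0HSYPlus/Lines/coupled_variantQ.lean`,
`stub_levelFixingSeven`) says: for every degree-6 parametrisation `Dt` of `E₉ = ⟨0,0,1,0,−1⟩` at level `243`, every prime
`p ≡ 7 (mod 9)`, `K ∋ ω`, `ι`, `v ∣ 3`, every `n ≠ 0` with all prime factors `≡ 2 (mod 3)`, every `K`-embedding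
`e : K[9pn] → K̄`, every `y ∈ E₉(K[9pn])` over `Dt.φ(τ_n)`, every `τ ∈ Γ_{K_v}` and every `φ ∈ Gal(K[9pn]/K)` with
`res τ ∘ e = e ∘ φ` and `φ² = 1`:  `φ · y = y`.  This file proves it

* ★★★ `levelFixingSeven_of_isS3Invariant` — for every `Dt` whose `Dt.φ` is `⟨w₂₄₃, A⟩`-invariant (`IsS3Invariant Dt`), with all
  other binders VERBATIM the stub's:  `φ = 1` is trivial; for `φ ≠ 1` the CM statement ★★
  `ringEquiv_apply_classJ_of_decompositionInvolution` (k7t-c2 g33 (IV): every `σ ∈ Aut ℂ` extending `φ` translates `Cl(−243p²n²)`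
  by `η*`) is exactly the displayed hypothesis `hCM` of w2b g0's assembler `levelFixing_of_translation_etaStar` (orbit forms on the
  three sheets `Aⁱ·w₂₄₃`, the class identities `[Q′] = [Q_n]·η*`, the Bezout engine, Darmon's `Aut(ℂ)`-equivariance, descent);
* ★★★ `levelFixingSeven_of_phi_s3Invariant` — **THE STUB'S TYPE VERBATIM** (`∀ Dt, Dt.deg = 6 → …`) **from the ONE displayed PRINT
  input (G3)** = k-ty1's named Literature fact `phi_s3Invariant_of_deg_eq_six` (HSY Prop. 2.1 (1): `E₉ = X₀(3⁵)/S₃`, so the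
  degree-6 `φ` is `⟨w₂₄₃, A⟩`-invariant; admitted as a print binder by planner D816/D819).

READING OF RECORD: `stub_levelFixingSeven ⟸ PRINT {(G3)}` — nothing else: no Shimura reciprocity law with a named Artin class, no
(G1), no HSY Thm 2.3; the name of the decomposition involution comes from the tree's PROVED Artin isomorphism / Chebotarev /
Deuring–Kronecker (files (I)–(IV) of this seat) and Hu–Shu–Yin's `S₃`-symmetry of `X₀(3⁵)` (w2b g0's files).

HONEST LABEL: CONDITIONAL on (G3) in the second theorem (first theorem: on `IsS3Invariant Dt`); closes no ledger item by itself (the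
planner's skeleton touch decides how `stub_levelFixingSeven` is discharged); nothing asserted on 19804 beyond this; X12.CMAtTwo NOT
proved; BSD is proved for no curve.

## References
* Y. Hu, J. Shu, H. Yin, Trans. AMS 372 (2019) = arXiv:1708.05266, §2.1 Prop. 2.1 (1), §2.2 Prop. 2.4, Thm. 2.2–2.3, §4.1. [HuShuYin2019]
* B. H. Gross, *Kolyvagin's work on modular elliptic curves*, LMS LNS 153 (1991), §3–§6. [GrossLMS1991]
* D. A. Cox, *Primes of the form x² + ny²*, 2nd ed. (2013), §7.C, §9.A, §11.D. [Cox2013]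
* H. Darmon, CBMS 101 (2004), Thm. 3.6–3.7. [Darmon2004]
-/

set_option autoImplicit false
-- the Summit-side namespace `Summit.BirchSwinnertonDyer.BirchSwinnertonDyer.…` (summit = problem) is mandated by D-0017
set_option linter.dupNamespace false

noncomputable section

open scoped Classical

namespace Summit.BirchSwinnertonDyer.BirchSwinnertonDyer.Theorems.SylvesterTwoLevelFixingSeven

open Field NumberField IsDedekindDomain IsDedekindDomain.HeightOneSpectrum Module WeierstrassCurve
  Literature.NumberTheory.EllipticCurves Literature.NumberTheory.EllipticCurves.ModularForms
  Literature.NumberTheory.EllipticCurves.HuShuYin2019 Literature.NumberTheory.GaloisRepresentations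
  Literature.NumberTheory.QuadraticFields.BinaryQuadraticForm Literature.NumberTheory.QuadraticFields.Quadratic
  Literature.Computability.Cryptography.Hallgren2005 Literature.Computability.Cryptography.Hallgren2005.OrderCl
  Summit.BirchSwinnertonDyer.BirchSwinnertonDyer.Theorems.SylvesterTwoLevelFixingGlue
  Summit.BirchSwinnertonDyer.BirchSwinnertonDyer.Theorems.SylvesterTwoLevelFixingDecomp
  Summit.BirchSwinnertonDyer.BirchSwinnertonDyer.Theorems.SylvesterTwoLevelFixingAssembly

set_option maxHeartbeats 1600000 in
/-- ★★★ **(W2-b) for every `⟨w₂₄₃, A⟩`-invariant parametrisation: the decomposition involution at `w ∣ 3` fixes `y_n`.**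
All binders after `hS3` are those of `stub_levelFixingSeven` verbatim. `φ = 1`: descent of the identity; `φ ≠ 1`: ★★
`ringEquiv_apply_classJ_of_decompositionInvolution` is the `hCM` input of `levelFixing_of_translation_etaStar`.
[cite: HuShuYin2019, §2.1 Prop. 2.1 (1), §2.2 Prop. 2.4 and Thm. 2.2–2.3, §4.1] [cite: GrossLMS1991, §3]
[cite: Cox2013, §7.C Prop. 7.22, §9.A, §11.D Cor. 11.37] [cite: Darmon2004, Thm. 3.6–3.7] -/
theorem levelFixingSeven_of_isS3Invariant
    (Dt : ModularParametrizationData (⟨0, 0, 1, 0, -1⟩ : WeierstrassCurve ℚ) 243) (hS3 : IsS3Invariant Dt) :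
    ∀ (p : ℕ), p.Prime → p % 9 = 7 → ∀ (K : Type) [Field K] [NumberField K] (ω : K), ω ^ 2 + ω + 1 = 0 →
      Module.finrank ℚ K = 2 → ∀ (ι : K →+* ℂ) (v : HeightOneSpectrum (𝓞 K)), ((3 : ℕ) : 𝓞 K) ∈ v.asIdeal →
      ∀ (n : ℕ), n ≠ 0 → (∀ q ∈ n.primeFactors, q % 3 = 2) →
      ∀ (e : ringClassField K ι (9 * p * n) →+* AlgebraicClosure K),
      (∀ k : K, e (algebraMap K (ringClassField K ι (9 * p * n)) k) = algebraMap K (AlgebraicClosure K) k) →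
      ∀ (y : ((⟨0, 0, 1, 0, -1⟩ : WeierstrassCurve ℚ).baseChange (ringClassField K ι (9 * p * n))).toAffine.Point),
      Affine.Point.map (W' := (⟨0, 0, 1, 0, -1⟩ : WeierstrassCurve ℚ)) (ringClassField K ι (9 * p * n)).subtype.toRatAlgHom y =
      Dt.φ (heegnerTau ((n : ℤ) ^ 2 * (81 * ((p : ℤ) ^ 2 + 4 * p + 16)),
      (n : ℤ) * (-(9 * (4 * (p : ℤ) ^ 2 + 17 * p + 72))), 4 * (p : ℤ) ^ 2 + 18 * p + 81)) →
      ∀ (τ : absoluteGaloisGroup (v.adicCompletion K))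
      (φ : ringClassField K ι (9 * p * n) ≃ₐ[K] ringClassField K ι (9 * p * n)),
      (∀ x : ringClassField K ι (9 * p * n), (show AlgebraicClosure K ≃ₐ[K] AlgebraicClosure K from
      resGal (K := K) (v.adicCompletion K) τ) (e x) = e (φ x)) → φ * φ = 1 →
      pointGalHom (⟨0, 0, 1, 0, -1⟩ : WeierstrassCurve ℚ) (ringClassField K ι (9 * p * n)) (φ.restrictScalars ℚ) y = y := by
  intro p hp hp9 K _ _ ω hω h2 ι v hv n hn hprimes e he y hy τ φ hτφ hφ2
  have hK : IsImaginaryQuadratic K := JZero.isImaginaryQuadratic_of_sq_add_self_add_one hω h2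
  have hp3 : p % 3 = 1 := by omega
  have hn3 : ¬ 3 ∣ n := by
    intro h3
    have h := hprimes 3 (Nat.mem_primeFactors.mpr ⟨Nat.prime_three, h3, hn⟩)
    omega
  have hm : 9 * p * n ≠ 0 := Nat.mul_ne_zero (Nat.mul_ne_zero (by norm_num) hp.ne_zero) hn
  by_cases hφ1 : φ = 1
  · -- the identity
    subst hφ1
    refine pointGalHom_eq_self_of_forall_ringEquiv hK ι hm _ 1 y fun σ hσ ↦ ?_
    rw [Affine.Point.map_map]
    exact Affine.Point.map_congr_fun (fun x ↦ by simpa using hσ x) _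
  · -- a non-trivial involution from `Γ_{K_v}`: the CM statement ★★ feeds the assembler
    have hD0 : ((9 * p * n : ℕ) : ℤ) ^ 2 * (-3) < 0 := by
      have h9 : (0 : ℤ) < ((9 * p * n : ℕ) : ℤ) := by exact_mod_cast Nat.pos_of_ne_zero hm
      nlinarith
    obtain ⟨Δ, hΔ⟩ : ∃ Δ : NegDiscr, Δ.D = ((9 * p * n : ℕ) : ℤ) ^ 2 * (-3) := ⟨⟨_, hD0⟩, rfl⟩
    exact levelFixing_of_translation_etaStar Dt hS3 hp9 hω h2 ι hn hprimes φ Δ hΔ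
      (fun σ hσ κ ↦ ringEquiv_apply_classJ_of_decompositionInvolution hω h2 ι hp hp3 hn hn3 v hv e he τ φ hτφ hφ2 hφ1
        Δ hΔ hσ κ) y hy

/-- ★★★ **`stub_levelFixingSeven`'S TYPE VERBATIM, FROM THE ONE DISPLAYED PRINT INPUT (G3)** = the named Literature fact
`phi_s3Invariant_of_deg_eq_six` (Hu–Shu–Yin Prop. 2.1 (1): the degree-6 parametrisation `X₀(3⁵) → E₉` is the quotient by
`S₃ = ⟨W, A⟩`, hence `Dt.φ` is `⟨w₂₄₃, A⟩`-invariant; typed by k-ty1, p749218; admitted as a print binder, planner D816/D819).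
CONDITIONAL on that fact; closes nothing on the ledger by itself; BSD is proved for no curve.
[cite: HuShuYin2019, §2.1 Prop. 2.1 (1), §2.2 Thm. 2.2–2.3, §4.1] [cite: DasguptaVoight2018, §2] [cite: GrossLMS1991, §3] -/
theorem levelFixingSeven_of_phi_s3Invariant (hG3 : phi_s3Invariant_of_deg_eq_six) :
    ∀ (Dt : ModularParametrizationData (⟨0, 0, 1, 0, -1⟩ : WeierstrassCurve ℚ) 243), Dt.deg = 6 →
      ∀ (p : ℕ), p.Prime → p % 9 = 7 → ∀ (K : Type) [Field K] [NumberField K] (ω : K), ω ^ 2 + ω + 1 = 0 →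
      Module.finrank ℚ K = 2 → ∀ (ι : K →+* ℂ) (v : HeightOneSpectrum (𝓞 K)), ((3 : ℕ) : 𝓞 K) ∈ v.asIdeal →
      ∀ (n : ℕ), n ≠ 0 → (∀ q ∈ n.primeFactors, q % 3 = 2) →
      ∀ (e : ringClassField K ι (9 * p * n) →+* AlgebraicClosure K),
      (∀ k : K, e (algebraMap K (ringClassField K ι (9 * p * n)) k) = algebraMap K (AlgebraicClosure K) k) →
      ∀ (y : ((⟨0, 0, 1, 0, -1⟩ : WeierstrassCurve ℚ).baseChange (ringClassField K ι (9 * p * n))).toAffine.Point),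
      Affine.Point.map (W' := (⟨0, 0, 1, 0, -1⟩ : WeierstrassCurve ℚ)) (ringClassField K ι (9 * p * n)).subtype.toRatAlgHom y =
      Dt.φ (heegnerTau ((n : ℤ) ^ 2 * (81 * ((p : ℤ) ^ 2 + 4 * p + 16)),
      (n : ℤ) * (-(9 * (4 * (p : ℤ) ^ 2 + 17 * p + 72))), 4 * (p : ℤ) ^ 2 + 18 * p + 81)) →
      ∀ (τ : absoluteGaloisGroup (v.adicCompletion K))
      (φ : ringClassField K ι (9 * p * n) ≃ₐ[K] ringClassField K ι (9 * p * n)),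
      (∀ x : ringClassField K ι (9 * p * n), (show AlgebraicClosure K ≃ₐ[K] AlgebraicClosure K from
      resGal (K := K) (v.adicCompletion K) τ) (e x) = e (φ x)) → φ * φ = 1 →
      pointGalHom (⟨0, 0, 1, 0, -1⟩ : WeierstrassCurve ℚ) (ringClassField K ι (9 * p * n)) (φ.restrictScalars ℚ) y = y :=
  fun Dt hdeg ↦ levelFixingSeven_of_isS3Invariant Dt (hG3 Dt hdeg)

end Summit.BirchSwinnertonDyer.BirchSwinnertonDyer.Theorems.SylvesterTwoLevelFixingSeven

end
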